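import Summits.CriticalPhenomena.PercolationContinuityZ3.Theorems.PercLowPointHalfSpaceTallClusterMassBoundStubSubharmonicTransfer
import Summits.CriticalPhenomena.PercolationContinuityZ3.Theorems.PercLowPointHalfSpaceLowPointBookkeepingOfSharpStubs
import Summits.CriticalPhenomena.PercolationContinuityZ3.Theorems.PercLowPointHalfSpaceLowPointBookkeepingSharpReduce
import Summits.CriticalPhenomena.PercolationContinuityZ3.Theorems.PercLowPointHalfSpaceLowPointBookkeepingSharpNoFatForms
import Literature.Probability.Percolation.TreeGraphBound

/-!
# Crux B `TallClusterMassBound` (stmt-CriticalPhenomena-0912) is BYPASSED: the route's bookkeeping line closes the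
# conjunct from `SquareSubharmonic` (stmt-11506) and the sharp floor two-arm bound alone (line `SketchIdeator4`, lead c4)

Route PercLowPointHalfSpace: `closes (hA hB hC hK)`, K = `LowPointBookkeeping := A → B → C → τ_{p_c}(0, n e₀) → 0`.
The live line of K (floor-russo, `Theorems/PercLowPointHalfSpaceLowPointBookkeeping*.lean`, leads 14713-0/c1/c2) closes K —
indeed `θ(p_c(ℤ³)) = 0` — from two hypothesis-stubs in which B, C and A-as-filed are idle
(`FloorRusso.Glue.percolationContinuityZ3_of_sharp`):

* (A♯ₛ) `stub_twoArmSharpFloorE1` — crux A's two-arm event with exponent `11/4 + κ` under the floor-diluted measures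
  `P^ℍ_{p_c,s}`, all `s` (canonical single-neighbour form, `FloorRusso.Reduce.stub_reduceTwoArm`);
* (B♯) `stub_noFatHalfBoxOrigin` — `P^ℍ_{p_c,1}(|K_max(B_n ∩ ℍ)| ≥ C n^{11/4}) ≤ e^{-1}`, i.e. the typical maximal cluster trace of the
  half-box is `≲ n^{11/4}` — crux B's residual C⁺ of line SketchIdeator4 AT the exponent `11/4` (not `<`), with the linear sufficient
  condition `Σ_{y ∈ B_n ∩ ℍ} P_{p_c}(x ↔_ℍ y) ≤ C n^{5/2}` (`FloorRusso.NoFatForms.stub_noFatOfSusceptibility`).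

This file supplies the one missing arrow and draws the consequence:

* `halfBoxSusceptibility_of_squareSubharmonic` — **stmt-11506 ⟹ the half-box susceptibility bound** `Σ_{y ∈ B_n ∩ ℍ} P_{p_c}(x ↔_ℍ y)
  ≤ C n^{5/2}` for all `x ∈ B_n ∩ ℍ`, `n ≥ 1`: `SquareSubharmonic` ⟹ `τ_{p_c}(0,z) ≤ C‖z‖^{-1/2}` (exterior maximum principle against the
  lattice Green function, `TightnessLine.tau_criticalProbI_le_of_subharmonicPower`, p118651) ⟹ ball sums `Σ_{B_R} τ_{p_c} ≤ C R^{5/2}`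
  (`ballSum_le_of_pointwise`) and `P(x ↔_ℍ y) ≤ τ(x,y) = τ(0, y - x)`, `y - x ∈ B_{2n}`;
* `noFatHalfBoxOrigin_of_squareSubharmonic` — **stmt-11506 ⟹ (B♯)** verbatim;
* `percolationContinuityZ3_of_squareSubharmonic_of_twoArmSharpFloorE1` — **`SquareSubharmonic` ∧ (A♯ₛ) ⟹ θ(p_c(ℤ³)) = 0**, and
  `lowPointBookkeeping_of_squareSubharmonic_of_twoArmSharpFloorE1` — the same two inputs give K.

So the route's open content is {(A♯ₛ), stmt-11506}: crux B (at `m = 11/4` or relaxed) and crux C are not on the proof path of its only live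
bookkeeping line, and B's residual is the SAME statement as K's (B♯), discharged by the same existing crux of route PercSubharmonicSquare.
No definitions, no new facts; every input named above is a landed theorem. [folklore]
-/

noncomputable section

open MeasureTheory Finset Filter Topology
open Literature.Probability.Percolation Literature.Probability.LatticeModels
open Summit.CriticalPhenomena.PercolationContinuityZ3.Theses.PercLowPointHalfSpace (LowPointBookkeeping)
open Summit.CriticalPhenomena.PercolationContinuityZ3.Theses.PercSubharmonicSquare (SquareSubharmonic)
open Summit.CriticalPhenomena.PercolationContinuityZ3.Theorems.TallClusterMassBound.Negative
open Summit.CriticalPhenomena.PercolationContinuityZ3.Theorems.TallClusterMassBound.TightnessLine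
  (tau_criticalProbI_le_of_subharmonicPower ballSum_le_of_pointwise)

namespace Summit.CriticalPhenomena.PercolationContinuityZ3.Theorems.TallClusterMassBound.Restatement

/-- **stmt-11506 ⟹ the truncated half-space susceptibility bound with exponent `5/2`.** If `τ_p²` is nearest-neighbour
sub-mean-value off a box for all `p < p_c(ℤ³)` (`SquareSubharmonic`), then for all `n ≥ 1` and `x ∈ B_n ∩ ℍ`,
`Σ_{y ∈ B_n ∩ ℍ} P_{p_c}(x ↔_ℍ y) ≤ C n^{5/2}`: pointwise `τ_{p_c}(0,z) ≤ C₀‖z‖^{-1/2}` (p118651), `P(x ↔_ℍ y) ≤ τ(x,y) = τ(0,y-x)`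
(translation invariance), `y - x ∈ B_{2n}`, and the ball sum `Σ_{B_{2n}} τ_{p_c}(0,·) ≤ K (2n)^{5/2}`. [folklore] -/
theorem halfBoxSusceptibility_of_squareSubharmonic (h : SquareSubharmonic) :
    ∃ C : ℝ, ∀ n : ℕ, 1 ≤ n → ∀ x ∈ (box 3 n).filter (fun z : Site 3 => 0 ≤ z 0),
      ∑ y ∈ (box 3 n).filter (fun z : Site 3 => 0 ≤ z 0),
        (bondPercolation (zdGraph 3) (criticalProbI 3)).real (openConnIn {x : Site 3 | 0 ≤ x 0} x y) ≤
          C * (n : ℝ) ^ ((5 : ℝ) / 2) := by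
  obtain ⟨R, hR⟩ := h
  have hsub : ∀ p : unitInterval, (p : ℝ) < criticalProb (zdGraph 3) (0 : Site 3) →
      ∀ x : Site 3, (R : ℝ) < ‖x‖ →
        tau 3 p 0 x ^ (2 : ℝ) ≤
          (1 / 6 : ℝ) * ∑ i : Fin 3, (tau 3 p 0 (x + Pi.single i 1) ^ (2 : ℝ) + tau 3 p 0 (x - Pi.single i 1) ^ (2 : ℝ)) := by
    intro p hp x hx
    simpa only [Real.rpow_two] using hR p hp x hx
  obtain ⟨C, hC0, hC⟩ := tau_criticalProbI_le_of_subharmonicPower (s := 2) (by norm_num) hsub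
  have hpt : ∀ x : Site 3, x ≠ 0 → tau 3 (criticalProbI 3) 0 x ≤ C * ‖x‖ ^ (-((1 : ℝ) / 2)) := by
    intro x hx
    simpa using hC x hx
  have hball := ballSum_le_of_pointwise (a := 1 / 2) (by norm_num) hC0.le hpt
  set K : ℝ := 1 + 26 * (1 + 1 / (3 - 1 / 2)) * C with hK
  refine ⟨K * (2 : ℝ) ^ ((5 : ℝ) / 2), fun n hn x hx => ?_⟩
  have h2n : 1 ≤ 2 * n := by omega
  have hx' : x ∈ box 3 n := (Finset.mem_filter.1 hx).1
  calc ∑ y ∈ (box 3 n).filter (fun z : Site 3 => 0 ≤ z 0),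
        (bondPercolation (zdGraph 3) (criticalProbI 3)).real (openConnIn {x : Site 3 | 0 ≤ x 0} x y)
      ≤ ∑ y ∈ (box 3 n).filter (fun z : Site 3 => 0 ≤ z 0), (Pp (criticalProbI 3)).real (openConn 0 (y - x)) := by
        refine Finset.sum_le_sum fun y _ => ?_
        calc (bondPercolation (zdGraph 3) (criticalProbI 3)).real (openConnIn {x : Site 3 | 0 ≤ x 0} x y)
            ≤ (bondPercolation (zdGraph 3) (criticalProbI 3)).real (openConn x y) :=
              measureReal_mono (openConnIn_subset_openConn _ x y)
          _ = tau 3 (criticalProbI 3) x y := (tau_def _ x y).symm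
          _ = tau 3 (criticalProbI 3) 0 (y - x) := tau_eq_tau_zero_sub _ x y
          _ = (Pp (criticalProbI 3)).real (openConn 0 (y - x)) := tau_def _ _ _
    _ = ∑ z ∈ ((box 3 n).filter (fun z : Site 3 => 0 ≤ z 0)).image (fun y : Site 3 => y - x),
          (Pp (criticalProbI 3)).real (openConn 0 z) := by
        rw [Finset.sum_image]
        intro a _ b _ hab
        exact sub_left_injective hab
    _ ≤ ∑ z ∈ box 3 (2 * n), (Pp (criticalProbI 3)).real (openConn 0 z) := by
        refine Finset.sum_le_sum_of_subset_of_nonneg ?_ (fun _ _ _ => measureReal_nonneg)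
        intro z hz
        rw [Finset.mem_image] at hz
        obtain ⟨y, hy, rfl⟩ := hz
        have hy' : y ∈ box 3 n := (Finset.mem_filter.1 hy).1
        rw [mem_box] at hy' hx' ⊢
        intro i
        have h1 := hy' i
        have h2 := hx' i
        simp only [Pi.sub_apply]
        push_cast
        omega
    _ ≤ K * ((2 * n : ℕ) : ℝ) ^ (3 - 1 / 2 : ℝ) := hball (2 * n) h2n
    _ = K * (2 : ℝ) ^ ((5 : ℝ) / 2) * (n : ℝ) ^ ((5 : ℝ) / 2) := by
        rw [show (3 - 1 / 2 : ℝ) = 5 / 2 by norm_num]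
        push_cast
        rw [Real.mul_rpow (by norm_num) (by positivity)]
        ring

/-- **stmt-11506 ⟹ (B♯)**, the no-fat-half-box hypothesis-stub `stub_noFatHalfBoxOrigin` of K's line, verbatim: the half-box susceptibility
bound of `halfBoxSusceptibility_of_squareSubharmonic` fed into the second-moment count `FloorRusso.NoFatForms.stub_noFatOfSusceptibility`
(p135105). [folklore] -/
theorem noFatHalfBoxOrigin_of_squareSubharmonic :
    Summit.CriticalPhenomena.PercolationContinuityZ3.Theses.PercSubharmonicSquare.SquareSubharmonic →
      ∃ C : ℝ, 0 < C ∧ ∀ n : ℕ, 1 ≤ n →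
        (floorDilutedPercolation 3 (criticalProbI 3) 1).real
          {ω | C * (n : ℝ) ^ ((11 : ℝ) / 4) ≤ (clusterMaxIn ((box 3 n).filter fun z : Site 3 => 0 ≤ z 0) ω : ℝ)} ≤ Real.exp (-1) :=
  fun h => FloorRusso.NoFatForms.stub_noFatOfSusceptibility (halfBoxSusceptibility_of_squareSubharmonic h)

/-- **`SquareSubharmonic` (stmt-11506) and the sharp floor two-arm bound (A♯ₛ, `stub_twoArmSharpFloorE1` of K's line, verbatim) give
`θ(p_c(ℤ³)) = 0`** — crux B, crux C and crux A as filed are not used: (A♯ₛ) for all four floor neighbours by lattice symmetry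
(`FloorRusso.Reduce.stub_reduceTwoArm`), (B♯) for the five half-boxes from the origin one (`stub_reduceNoFat`), then the floor-russo
composition `FloorRusso.Glue.percolationContinuityZ3_of_sharp` (window average of `τ_{p_c}(0,·)` against `θ² ≤ τ`). [folklore] -/
theorem percolationContinuityZ3_of_squareSubharmonic_of_twoArmSharpFloorE1 :
    Summit.CriticalPhenomena.PercolationContinuityZ3.Theses.PercSubharmonicSquare.SquareSubharmonic →
      (∃ κ C : ℝ, 0 < κ ∧ ∀ s : unitInterval, ∀ r : ℕ, 1 ≤ r →
        (floorDilutedPercolation 3 (criticalProbI 3) s).real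
          ({ω | ∃ y : Site 3, (∃ i : Fin 3, ((r : ℕ) : ℤ) ≤ |y i|) ∧ ω ∈ openConnIn {x : Site 3 | 0 ≤ x 0} 0 y} ∩
            {ω | ∃ y : Site 3, (∃ i : Fin 3, ((r : ℕ) : ℤ) ≤ |y i - (Pi.single 1 1 : Site 3) i|) ∧
              ω ∈ openConnIn {x : Site 3 | 0 ≤ x 0} (Pi.single 1 1) y} ∩
            (openConnIn {x : Site 3 | 0 ≤ x 0} 0 (Pi.single 1 1))ᶜ) ≤ C * (r : ℝ) ^ (-(11 / 4 + κ))) →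
        _root_.PercolationContinuityZ3 :=
  fun h hA => FloorRusso.Glue.percolationContinuityZ3_of_sharp (FloorRusso.Reduce.stub_reduceTwoArm hA)
    (FloorRusso.Reduce.stub_reduceNoFat (noFatHalfBoxOrigin_of_squareSubharmonic h))

/-- **The same two inputs give the bookkeeping crux K** (`LowPointBookkeeping`; its own hypotheses A, B, C idle), through
`FloorRusso.Glue.lowPointBookkeeping_of_sharp`. [folklore] -/
theorem lowPointBookkeeping_of_squareSubharmonic_of_twoArmSharpFloorE1 :
    Summit.CriticalPhenomena.PercolationContinuityZ3.Theses.PercSubharmonicSquare.SquareSubharmonic →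
      (∃ κ C : ℝ, 0 < κ ∧ ∀ s : unitInterval, ∀ r : ℕ, 1 ≤ r →
        (floorDilutedPercolation 3 (criticalProbI 3) s).real
          ({ω | ∃ y : Site 3, (∃ i : Fin 3, ((r : ℕ) : ℤ) ≤ |y i|) ∧ ω ∈ openConnIn {x : Site 3 | 0 ≤ x 0} 0 y} ∩
            {ω | ∃ y : Site 3, (∃ i : Fin 3, ((r : ℕ) : ℤ) ≤ |y i - (Pi.single 1 1 : Site 3) i|) ∧
              ω ∈ openConnIn {x : Site 3 | 0 ≤ x 0} (Pi.single 1 1) y} ∩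
            (openConnIn {x : Site 3 | 0 ≤ x 0} 0 (Pi.single 1 1))ᶜ) ≤ C * (r : ℝ) ^ (-(11 / 4 + κ))) →
        Summit.CriticalPhenomena.PercolationContinuityZ3.Theses.PercLowPointHalfSpace.LowPointBookkeeping :=
  fun h hA => FloorRusso.Glue.lowPointBookkeeping_of_sharp (FloorRusso.Reduce.stub_reduceTwoArm hA)
    (FloorRusso.Reduce.stub_reduceNoFat (noFatHalfBoxOrigin_of_squareSubharmonic h))

/-! ## Appendix (lead c4): calibration against the bulk ball sum `Σ_{B_R} τ_{p_c}(0,·) ≤ C R^{5/2}` ("η ≥ −1/2 on average")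

The arrow stmt-11506 ⟹ (B♯) factors through the AVERAGED critical two-point bound at rate exactly `1/2`,
`Σ_{z ∈ B_R} τ_{p_c}(0,z) ≤ C R^{5/2}` for all `R ≥ 1` (heuristically `R^{2-η}`, `η(3) ≈ −0.05`). Two honest remarks for the planner:
(1) as a HYPOTHESIS the bulk ball sum at ANY sub-volume rate is a costume of the conjunct (`τ ≥ θ²` pointwise, so `θ² ≤ |B_R|^{-1} Σ_{B_R} τ → 0`),
exactly like `SquareSubharmonic`; (2) the ℍ-native forms it feeds — the half-box susceptibility bound `Σ_{y ∈ B_n ∩ ℍ} P_{p_c}(x ↔_ℍ y) ≤ C n^{5/2}`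
and (B♯) — are NOT known to close the conjunct by themselves (`τ_ℍ ≥ θ_ℍ² = 0` by BGN carries no information; a2/c1 analysis of C⁺). So the
arrows below only CALIBRATE B♯: it sits below the standard averaged `η ≥ −1/2` bound, and the route's B-side is informative only through a proof
of the ℍ-native forms that avoids bulk decay. -/

/-- **Ball sum at rate `1/2` ⟹ half-box susceptibility `≤ C' n^{5/2}`**: `P(x ↔_ℍ y) ≤ τ(x,y) = τ(0, y - x)` and `y - x ∈ B_{2n}` for
`x, y ∈ B_n`. [folklore] -/
theorem halfBoxSusceptibility_of_ballSum
    (hS : ∃ C : ℝ, ∀ R : ℕ, 1 ≤ R →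
      ∑ z ∈ box 3 R, (bondPercolation (zdGraph 3) (criticalProbI 3)).real (openConn (0 : Site 3) z) ≤ C * (R : ℝ) ^ ((5 : ℝ) / 2)) :
    ∃ C : ℝ, ∀ n : ℕ, 1 ≤ n → ∀ x ∈ (box 3 n).filter (fun z : Site 3 => 0 ≤ z 0),
      ∑ y ∈ (box 3 n).filter (fun z : Site 3 => 0 ≤ z 0),
        (bondPercolation (zdGraph 3) (criticalProbI 3)).real (openConnIn {x : Site 3 | 0 ≤ x 0} x y) ≤
          C * (n : ℝ) ^ ((5 : ℝ) / 2) := by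
  obtain ⟨K, hK⟩ := hS
  refine ⟨K * (2 : ℝ) ^ ((5 : ℝ) / 2), fun n hn x hx => ?_⟩
  have h2n : 1 ≤ 2 * n := by omega
  have hx' : x ∈ box 3 n := (Finset.mem_filter.1 hx).1
  calc ∑ y ∈ (box 3 n).filter (fun z : Site 3 => 0 ≤ z 0),
        (bondPercolation (zdGraph 3) (criticalProbI 3)).real (openConnIn {x : Site 3 | 0 ≤ x 0} x y)
      ≤ ∑ y ∈ (box 3 n).filter (fun z : Site 3 => 0 ≤ z 0),
          (bondPercolation (zdGraph 3) (criticalProbI 3)).real (openConn (0 : Site 3) (y - x)) := by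
        refine Finset.sum_le_sum fun y _ => ?_
        calc (bondPercolation (zdGraph 3) (criticalProbI 3)).real (openConnIn {x : Site 3 | 0 ≤ x 0} x y)
            ≤ (bondPercolation (zdGraph 3) (criticalProbI 3)).real (openConn x y) :=
              measureReal_mono (openConnIn_subset_openConn _ x y)
          _ = tau 3 (criticalProbI 3) x y := (tau_def _ x y).symm
          _ = tau 3 (criticalProbI 3) 0 (y - x) := tau_eq_tau_zero_sub _ x y
          _ = (bondPercolation (zdGraph 3) (criticalProbI 3)).real (openConn (0 : Site 3) (y - x)) := tau_def _ _ _
    _ = ∑ z ∈ ((box 3 n).filter (fun z : Site 3 => 0 ≤ z 0)).image (fun y : Site 3 => y - x),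
          (bondPercolation (zdGraph 3) (criticalProbI 3)).real (openConn (0 : Site 3) z) := by
        rw [Finset.sum_image]
        intro a _ b _ hab
        exact sub_left_injective hab
    _ ≤ ∑ z ∈ box 3 (2 * n), (bondPercolation (zdGraph 3) (criticalProbI 3)).real (openConn (0 : Site 3) z) := by
        refine Finset.sum_le_sum_of_subset_of_nonneg ?_ (fun _ _ _ => measureReal_nonneg)
        intro z hz
        rw [Finset.mem_image] at hz
        obtain ⟨y, hy, rfl⟩ := hz
        have hy' : y ∈ box 3 n := (Finset.mem_filter.1 hy).1
        rw [mem_box] at hy' hx' ⊢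
        intro i
        have h1 := hy' i
        have h2 := hx' i
        simp only [Pi.sub_apply]
        push_cast
        omega
    _ ≤ K * ((2 * n : ℕ) : ℝ) ^ ((5 : ℝ) / 2) := hK (2 * n) h2n
    _ = K * (2 : ℝ) ^ ((5 : ℝ) / 2) * (n : ℝ) ^ ((5 : ℝ) / 2) := by
        push_cast
        rw [Real.mul_rpow (by norm_num) (by positivity)]
        ring

/-- **Ball sum at rate `1/2` ⟹ (B♯)** (`stub_noFatHalfBoxOrigin` of crux K's line, verbatim): half-box susceptibility
(`halfBoxSusceptibility_of_ballSum`) and the K-line's second-moment count (`FloorRusso.NoFatForms.stub_noFatOfSusceptibility`). Calibration only —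
see the remarks above: the hypothesis by itself already closes the conjunct. [folklore] -/
theorem noFatHalfBoxOrigin_of_ballSum :
    (∃ C : ℝ, ∀ R : ℕ, 1 ≤ R →
      ∑ z ∈ box 3 R, (bondPercolation (zdGraph 3) (criticalProbI 3)).real (openConn (0 : Site 3) z) ≤ C * (R : ℝ) ^ ((5 : ℝ) / 2)) →
      ∃ C : ℝ, 0 < C ∧ ∀ n : ℕ, 1 ≤ n →
        (floorDilutedPercolation 3 (criticalProbI 3) 1).real
          {ω | C * (n : ℝ) ^ ((11 : ℝ) / 4) ≤ (clusterMaxIn ((box 3 n).filter fun z : Site 3 => 0 ≤ z 0) ω : ℝ)} ≤ Real.exp (-1) :=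
  fun hS => FloorRusso.NoFatForms.stub_noFatOfSusceptibility (halfBoxSusceptibility_of_ballSum hS)

end Summit.CriticalPhenomena.PercolationContinuityZ3.Theorems.TallClusterMassBound.Restatement
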